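import Literature.Topology.FourManifolds.LevelTransport
import Literature.Topology.FourManifolds.OrientationDiffeotopy
import Literature.Topology.FourManifolds.OrientedConnectedSumSphereSelf
import Literature.Topology.FourManifolds.BoundaryOrientation
import HarnessLib

/-!
# The flow between two levels preserves the boundary orientations of the levels

Topic `Literature/Topology/FourManifolds` (fact seat
`provefact-Literature.Topology.FourManifolds.IsHandlebody.exists_diffeomorph_isBoundaryGluing_sphere`,
step F2b₁ of the Lickorish–Wallace DAG; level step H2 of the reduction of L1
`oneHandle_nonempty_diffeomorph`: orientation characters of the feet of a handle, computed in
the level of the feet for the boundary orientation induced by an ambient orientation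
(`HandleFeetOrientation.lean`), must be comparable with characters read in a lower level after
flowing down; this file shows that nothing changes).  Everything here is **proved**; no named
facts.

Let `S` be a unit-speed slab on `M` (`LevelFlowExtension.lean`), `oM` an orientation of `M`,
and `ℓ₁`, `ℓ₂` two levels of the slab with interior regular sublevel sets `Wᵢ = {f ≤ ℓᵢ}`
(structures `sublevelAtlas`).  Each `Wᵢ` carries the orientation `oWᵢ` pulled back from `oM`
along the inclusion (`SmoothOrientation.comapOfDetNeZero`, Hirsch 1976, §4.4 p. 101), and each
level manifold `∂Wᵢ` its boundary orientation `oWᵢ.boundary` (`BoundaryOrientation.lean`) —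
the **canonical level orientation** `UnitSlab.levelOrientation oM ℓᵢ`.  The flow
`θ_T`, `T = ℓ₂ - ℓ₁`, restricted to the levels is the diffeomorphism
`UnitSlab.levelFlowDiffeomorph` (`LevelTransport.lean`).

* `UnitSlab.flowDiffeotopy`, `isOrientationPreserving_flow` — the flow is a diffeotopy of
  `M`, so every stage `θ_T` preserves `oM` (`Diffeotopy.isOrientationPreserving_stage`,
  `OrientationDiffeotopy.lean`; Hirsch 1976, Ch. 8 §1).
* `isOrientationPreserving_boundaryMap_local` — the functoriality of boundary orientations
  (`IsOrientationPreserving.boundaryMap`, Hirsch §4.4 p. 103) with hypotheses only at the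
  boundary points (the proof in the tree is pointwise).
* `UnitSlab.levelFlowDiffeomorph_isOrientationPreserving` — **the flow map of the levels
  preserves the canonical level orientations**: near `∂W₁` the map `x ↦ θ_T x` takes `W₁` into
  `W₂`, is smooth with invertible differential and preserves `(oW₁, oW₂)` (cancel the
  orientation-preserving inclusions, `IsOrientationPreserving.of_comp_left`), and restricts on
  the boundary to the flow map of the levels.

## References

* M. W. Hirsch, *Differential Topology*, GTM 33 (1976), Ch. 4 §4, pp. 101–103; Ch. 8 §1.
  [HirschDT1976]
* J. Milnor, *Lectures on the h-cobordism theorem* (1965), Thm. 3.4. [MilnorHCobordism1965]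
-/

open scoped Manifold ContDiff Topology
open Set Function Filter Metric Module

noncomputable section

namespace Literature.Topology.FourManifolds

universe u

/-- Local notation: `𝔼 n` is the model Euclidean space `EuclideanSpace ℝ (Fin n)`. -/
local notation "𝔼 " n:arg => EuclideanSpace ℝ (Fin n)

/-! ### Functoriality of boundary orientations, local form -/

section Local

variable {n : ℕ} {W : Type u} [TopologicalSpace W] [ChartedSpace (EuclideanHalfSpace (n + 1)) W]
  [IsManifold (𝓡∂ (n + 1)) ∞ W] {W' : Type u} [TopologicalSpace W'] [ChartedSpace (EuclideanHalfSpace (n + 1)) W']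
  [IsManifold (𝓡∂ (n + 1)) ∞ W']

/-- **Boundary restrictions of maps which are orientation preserving at the boundary preserve the
boundary orientations** (`IsOrientationPreserving.boundaryMap` with its hypotheses —
differentiability, invertible differential, orientation character — required at the boundary
points only; the tree's proof is pointwise). [cite: HirschDT1976, §4.4 p. 103] -/
theorem isOrientationPreserving_boundaryMap_local {Φ : W → W'}
    {ρ : (𝓡∂ (n + 1)).boundary W → (𝓡∂ (n + 1)).boundary W'} (hρ : ∀ z, (ρ z).1 = Φ z.1)
    (hΦ : ∀ z : (𝓡∂ (n + 1)).boundary W, MDifferentiableAt (𝓡∂ (n + 1)) (𝓡∂ (n + 1)) Φ z.1) (hρc : Continuous ρ)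
    (hdet : ∀ z : (𝓡∂ (n + 1)).boundary W, LinearMap.det (M := 𝔼 (n + 1))
      (mfderiv (𝓡∂ (n + 1)) (𝓡∂ (n + 1)) Φ z.1).toLinearMap ≠ 0)
    {o : SmoothOrientation (𝓡∂ (n + 1)) W} {o' : SmoothOrientation (𝓡∂ (n + 1)) W'}
    (h : ∀ z : (𝓡∂ (n + 1)).boundary W, (o' (Φ z.1) = o z.1 ↔
      0 < LinearMap.det (M := 𝔼 (n + 1)) (mfderiv (𝓡∂ (n + 1)) (𝓡∂ (n + 1)) Φ z.1).toLinearMap)) :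
    IsOrientationPreserving o.boundary o'.boundary ρ := by
  intro z
  obtain ⟨hd, hiff⟩ := BoundaryManifold.hasMFDerivAt_boundaryMap hρ (hΦ z) hρc.continuousAt (hdet z)
  rw [hd.mfderiv, SmoothOrientation.boundary_apply, SmoothOrientation.boundary_apply, hρ z,
    boundaryOrientationMap_eq_iff, h z]
  exact hiff

end Local

namespace UnitSlab

variable {n : ℕ} {M : Type u} [TopologicalSpace M] [ChartedSpace (EuclideanHalfSpace (n + 1)) M]
  [IsManifold (𝓡∂ (n + 1)) ∞ M] (S : UnitSlab (n := n) M)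

/-! ### The flow is a diffeotopy; its stages preserve every orientation -/

/-- **The flow of a slab as a diffeotopy of `M`.** [cite: HirschDT1976, Ch. 8 §1, p. 178] -/
def flowDiffeotopy : Diffeotopy (𝓡∂ (n + 1)) M :=
  Diffeotopy.mk' (𝓡∂ (n + 1)) (fun t x => S.θ (t, x)) (fun t x => S.θ (-t, x)) S.flow.contMDiff
    (S.flow.contMDiff.comp ((contMDiff_fst.neg).prodMk contMDiff_snd))
    (fun t x => S.flow_neg_flow t x) (fun t x => S.flow_flow_neg t x) (funext fun x => S.isFlowOf.map_zero x)

omit [IsManifold (𝓡∂ (n + 1)) ∞ M] in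
/-- The stages of the flow diffeotopy. [folklore] -/
@[simp] theorem flowDiffeotopy_toFun (t : ℝ) (x : M) : S.flowDiffeotopy.toFun t x = S.θ (t, x) := rfl

/-- **Every stage of the flow preserves every orientation of `M`.** [cite: HirschDT1976, Ch. 8 §1] -/
theorem isOrientationPreserving_flow (oM : SmoothOrientation (𝓡∂ (n + 1)) M) (t : ℝ) :
    IsOrientationPreserving oM oM fun x => S.θ (t, x) :=
  S.flowDiffeotopy.isOrientationPreserving_stage oM t

omit [IsManifold (𝓡∂ (n + 1)) ∞ M] in
/-- The flow has invertible differentials. [folklore] -/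
theorem det_mfderiv_flow_ne_zero (t : ℝ) (x : M) :
    LinearMap.det (M := 𝔼 (n + 1)) (mfderiv (𝓡∂ (n + 1)) (𝓡∂ (n + 1)) (fun x => S.θ (t, x)) x).toLinearMap ≠ 0 :=
  (S.flowDiffeotopy.stage t).det_mfderiv_ne_zero (by simp) x

/-! ### The canonical orientations of the sublevel sets and of the levels -/

variable {ℓ : ℝ}
  {hint : ∀ p, S.f p ≤ ℓ → (𝓡∂ (n + 1)).IsInteriorPoint p}
  {hreg : ∀ p, S.f p = ℓ → ¬ IsMCriticalPt (𝓡∂ (n + 1)) S.f p}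
  [cs : ChartedSpace (EuclideanHalfSpace (n + 1)) ↥(S.f ⁻¹' Iic ℓ)]
  (hcs : cs = (sublevelAtlas S.hf ℓ hint hreg).chartedSpace)
  [mfd : IsManifold (𝓡∂ (n + 1)) ∞ ↥(S.f ⁻¹' Iic ℓ)]

include hcs in
/-- The inclusion `{f ≤ ℓ} → M` has invertible differentials (dimension `≥ 2`). [folklore] -/
theorem det_mfderiv_val_ne_zero (hn : 1 ≤ n) (x : ↥(S.f ⁻¹' Iic ℓ)) :
    LinearMap.det (M := 𝔼 (n + 1)) (mfderiv (𝓡∂ (n + 1)) (𝓡∂ (n + 1))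
      (Subtype.val : ↥(S.f ⁻¹' Iic ℓ) → M) x).toLinearMap ≠ 0 := by
  subst hcs
  letI := (sublevelAtlas S.hf ℓ hint hreg).chartedSpace
  exact det_mfderiv_ne_zero_of_isImmersionAt (((sublevelAtlas S.hf ℓ hint hreg).isImmersion_subtype_val hn).isImmersionAt x)

/-- **The canonical orientation of the sublevel set** `{f ≤ ℓ}`: pulled back from `oM` along
the inclusion. [cite: HirschDT1976, §4.4 p. 101] -/
def sublevelOrientation (oM : SmoothOrientation (𝓡∂ (n + 1)) M) (hn : 1 ≤ n) :
    SmoothOrientation (𝓡∂ (n + 1)) ↥(S.f ⁻¹' Iic ℓ) :=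
  oM.comapOfDetNeZero Subtype.val (S.contMDiff_val hcs hn) (by simp) (S.det_mfderiv_val_ne_zero hcs hn)

/-- The inclusion preserves `(sublevelOrientation, oM)`. [cite: HirschDT1976, §4.4 p. 101] -/
theorem isOrientationPreserving_val (oM : SmoothOrientation (𝓡∂ (n + 1)) M) (hn : 1 ≤ n) :
    IsOrientationPreserving (S.sublevelOrientation hcs oM hn) oM (Subtype.val : ↥(S.f ⁻¹' Iic ℓ) → M) :=
  SmoothOrientation.isOrientationPreserving_comapOfDetNeZero oM _ _ _ _

/-- **The canonical orientation of the level** `∂{f ≤ ℓ}`: the boundary orientation of the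
canonical orientation of the sublevel set. [cite: HirschDT1976, §4.4 p. 103] -/
def levelOrientation (oM : SmoothOrientation (𝓡∂ (n + 1)) M) (hn : 1 ≤ n) : SmoothOrientation (𝓡 n) (S.Level ℓ) :=
  (S.sublevelOrientation hcs oM hn).boundary

/-! ### The flow map of the levels preserves the canonical level orientations -/

variable {ℓ₁ ℓ₂ : ℝ}
  {hint₁ : ∀ p, S.f p ≤ ℓ₁ → (𝓡∂ (n + 1)).IsInteriorPoint p}
  {hreg₁ : ∀ p, S.f p = ℓ₁ → ¬ IsMCriticalPt (𝓡∂ (n + 1)) S.f p}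
  {hint₂ : ∀ p, S.f p ≤ ℓ₂ → (𝓡∂ (n + 1)).IsInteriorPoint p}
  {hreg₂ : ∀ p, S.f p = ℓ₂ → ¬ IsMCriticalPt (𝓡∂ (n + 1)) S.f p}
  [cs₁ : ChartedSpace (EuclideanHalfSpace (n + 1)) ↥(S.f ⁻¹' Iic ℓ₁)]
  [cs₂ : ChartedSpace (EuclideanHalfSpace (n + 1)) ↥(S.f ⁻¹' Iic ℓ₂)]
  (hcs₁ : cs₁ = (sublevelAtlas S.hf ℓ₁ hint₁ hreg₁).chartedSpace)
  (hcs₂ : cs₂ = (sublevelAtlas S.hf ℓ₂ hint₂ hreg₂).chartedSpace)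
  [mfd₁ : IsManifold (𝓡∂ (n + 1)) ∞ ↥(S.f ⁻¹' Iic ℓ₁)] [mfd₂ : IsManifold (𝓡∂ (n + 1)) ∞ ↥(S.f ⁻¹' Iic ℓ₂)]
  (h₁ : ℓ₁ ∈ Ioo S.lo S.hi) (h₂ : ℓ₂ ∈ Ioo S.lo S.hi)

/-- The collar of `W₁ = {f ≤ ℓ₁}` which the flow `θ_{ℓ₂ - ℓ₁}` takes into `W₂` (an open
submanifold of `W₁`). [folklore] -/
def flowCollar (S : UnitSlab (n := n) M) (ℓ₁ ℓ₂ : ℝ) : TopologicalSpace.Opens ↥(S.f ⁻¹' Iic ℓ₁) :=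
  ⟨{x | S.lo < S.f x ∧ S.lo < S.f x + (ℓ₂ - ℓ₁)},
    (isOpen_lt continuous_const (S.hf.continuous.comp continuous_subtype_val)).inter
      (isOpen_lt continuous_const ((S.hf.continuous.comp continuous_subtype_val).add continuous_const))⟩

omit [IsManifold (𝓡∂ (n + 1)) ∞ M] cs₁ cs₂ mfd₁ mfd₂ in
include h₁ h₂ in
/-- The flow takes the collar into `W₂`. [folklore] -/
theorem apply_flow_le_of_mem_flowCollar (x : S.flowCollar ℓ₁ ℓ₂) :
    S.f (S.θ (ℓ₂ - ℓ₁, ((x : ↥(S.f ⁻¹' Iic ℓ₁)) : M))) ≤ ℓ₂ := by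
  have hx : S.f ((x : ↥(S.f ⁻¹' Iic ℓ₁)) : M) ≤ ℓ₁ := (x : ↥(S.f ⁻¹' Iic ℓ₁)).2
  obtain ⟨h1, h2⟩ := x.2
  rw [S.apply_flow ⟨h1, by linarith [h₁.2]⟩ ⟨h2, by linarith [h₂.2]⟩]
  linarith

/-- **The flow on the collar, as a map into `W₂`.** [folklore] -/
def flowCollarMap (x : S.flowCollar ℓ₁ ℓ₂) : ↥(S.f ⁻¹' Iic ℓ₂) :=
  ⟨S.θ (ℓ₂ - ℓ₁, ((x : ↥(S.f ⁻¹' Iic ℓ₁)) : M)), S.apply_flow_le_of_mem_flowCollar h₁ h₂ x⟩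

omit [IsManifold (𝓡∂ (n + 1)) ∞ M] cs₁ cs₂ mfd₁ mfd₂ in
/-- The collar map on points. [folklore] -/
@[simp] theorem flowCollarMap_coe (x : S.flowCollar ℓ₁ ℓ₂) :
    ((S.flowCollarMap h₁ h₂ x : ↥(S.f ⁻¹' Iic ℓ₂)) : M) = S.θ (ℓ₂ - ℓ₁, ((x : ↥(S.f ⁻¹' Iic ℓ₁)) : M)) := rfl

include hcs₁ hcs₂ in
/-- The collar map is smooth. [cite: LeeSmoothManifolds2013, Cor. 5.30] -/
theorem contMDiff_flowCollarMap (hn : 1 ≤ n) : ContMDiff (𝓡∂ (n + 1)) (𝓡∂ (n + 1)) ∞ (S.flowCollarMap h₁ h₂) := by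
  have hg : ContMDiff (𝓡∂ (n + 1)) (𝓡∂ (n + 1)) ∞ fun x : S.flowCollar ℓ₁ ℓ₂ =>
      S.θ (ℓ₂ - ℓ₁, ((x : ↥(S.f ⁻¹' Iic ℓ₁)) : M)) :=
    S.flow.contMDiff.comp (contMDiff_const.prodMk ((S.contMDiff_val hcs₁ hn).comp contMDiff_subtype_val))
  subst hcs₂
  letI := (sublevelAtlas S.hf ℓ₂ hint₂ hreg₂).chartedSpace
  exact (sublevelAtlas S.hf ℓ₂ hint₂ hreg₂).contMDiff_codRestrict (fun x => S.apply_flow_le_of_mem_flowCollar h₁ h₂ x) hg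

/-- **The collar map preserves the canonical orientations** (cancel the inclusion of `W₂` on
the left of `val ∘ Φ = θ_T ∘ val ∘ val`). [cite: HirschDT1976, §4.4 p. 101] -/
theorem flowCollarMap_isOrientationPreserving (oM : SmoothOrientation (𝓡∂ (n + 1)) M) (hn : 1 ≤ n) :
    IsOrientationPreserving ((S.sublevelOrientation hcs₁ oM hn).restrict (S.flowCollar ℓ₁ ℓ₂))
      (S.sublevelOrientation hcs₂ oM hn) (S.flowCollarMap h₁ h₂) ∧
    ∀ x, LinearMap.det (M := 𝔼 (n + 1)) (mfderiv (𝓡∂ (n + 1)) (𝓡∂ (n + 1)) (S.flowCollarMap h₁ h₂) x).toLinearMap ≠ 0 := by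
  have hn' : (∞ : ℕ∞ω) ≠ 0 := by simp
  set Φ := S.flowCollarMap h₁ h₂ with hΦ
  set o₁ := S.sublevelOrientation hcs₁ oM hn with ho₁
  set o₂ := S.sublevelOrientation hcs₂ oM hn with ho₂
  -- the inner composite `val ∘ val_U : U → M`
  have hvalU : IsOrientationPreserving (o₁.restrict (S.flowCollar ℓ₁ ℓ₂)) o₁
      (Subtype.val : S.flowCollar ℓ₁ ℓ₂ → ↥(S.f ⁻¹' Iic ℓ₁)) := fun y => by
    rw [det_mfderiv_subtype_val, SmoothOrientation.restrict_apply]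
    exact iff_of_true rfl one_pos
  have hval₁ := S.isOrientationPreserving_val hcs₁ oM hn
  have hval₂ := S.isOrientationPreserving_val hcs₂ oM hn
  have hmd₁ : MDifferentiable (𝓡∂ (n + 1)) (𝓡∂ (n + 1)) (Subtype.val : ↥(S.f ⁻¹' Iic ℓ₁) → M) :=
    (S.contMDiff_val hcs₁ hn).mdifferentiable hn'
  have hmd₂ : MDifferentiable (𝓡∂ (n + 1)) (𝓡∂ (n + 1)) (Subtype.val : ↥(S.f ⁻¹' Iic ℓ₂) → M) :=
    (S.contMDiff_val hcs₂ hn).mdifferentiable hn'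
  have hmdU : MDifferentiable (𝓡∂ (n + 1)) (𝓡∂ (n + 1)) (Subtype.val : S.flowCollar ℓ₁ ℓ₂ → ↥(S.f ⁻¹' Iic ℓ₁)) :=
    fun y => mdifferentiableAt_subtype_val y
  have hdetU : ∀ y : S.flowCollar ℓ₁ ℓ₂, LinearMap.det (M := 𝔼 (n + 1)) (mfderiv (𝓡∂ (n + 1)) (𝓡∂ (n + 1))
      (Subtype.val : S.flowCollar ℓ₁ ℓ₂ → ↥(S.f ⁻¹' Iic ℓ₁)) y).toLinearMap ≠ 0 := fun y => by
    rw [det_mfderiv_subtype_val]; exact one_ne_zero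
  have hinner : IsOrientationPreserving (o₁.restrict (S.flowCollar ℓ₁ ℓ₂)) oM
      ((Subtype.val : ↥(S.f ⁻¹' Iic ℓ₁) → M) ∘ (Subtype.val : S.flowCollar ℓ₁ ℓ₂ → ↥(S.f ⁻¹' Iic ℓ₁))) :=
    IsOrientationPreserving.comp_holds hval₁ hvalU hmd₁ hmdU (S.det_mfderiv_val_ne_zero hcs₁ hn) hdetU
  have hinner_md : MDifferentiable (𝓡∂ (n + 1)) (𝓡∂ (n + 1))
      ((Subtype.val : ↥(S.f ⁻¹' Iic ℓ₁) → M) ∘ (Subtype.val : S.flowCollar ℓ₁ ℓ₂ → ↥(S.f ⁻¹' Iic ℓ₁))) :=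
    hmd₁.comp hmdU
  have hinner_det : ∀ y, LinearMap.det (M := 𝔼 (n + 1)) (mfderiv (𝓡∂ (n + 1)) (𝓡∂ (n + 1))
      ((Subtype.val : ↥(S.f ⁻¹' Iic ℓ₁) → M) ∘ (Subtype.val : S.flowCollar ℓ₁ ℓ₂ → ↥(S.f ⁻¹' Iic ℓ₁))) y).toLinearMap ≠ 0 :=
    fun y => det_mfderiv_comp_ne_zero y (hmd₁ _) (hmdU y) (S.det_mfderiv_val_ne_zero hcs₁ hn _) (hdetU y)
  -- `θ_T ∘ val ∘ val_U` preserves `(o₁|_U, oM)`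
  have hθ := S.isOrientationPreserving_flow oM (ℓ₂ - ℓ₁)
  have hθmd : MDifferentiable (𝓡∂ (n + 1)) (𝓡∂ (n + 1)) fun x => S.θ (ℓ₂ - ℓ₁, x) :=
    (S.flowDiffeotopy.stage (ℓ₂ - ℓ₁)).mdifferentiable hn'
  have hcomp : IsOrientationPreserving (o₁.restrict (S.flowCollar ℓ₁ ℓ₂)) oM
      ((fun x => S.θ (ℓ₂ - ℓ₁, x)) ∘ ((Subtype.val : ↥(S.f ⁻¹' Iic ℓ₁) → M) ∘
        (Subtype.val : S.flowCollar ℓ₁ ℓ₂ → ↥(S.f ⁻¹' Iic ℓ₁)))) :=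
    IsOrientationPreserving.comp_holds hθ hinner hθmd hinner_md (S.det_mfderiv_flow_ne_zero (ℓ₂ - ℓ₁)) hinner_det
  have hcomp_det : ∀ y, LinearMap.det (M := 𝔼 (n + 1)) (mfderiv (𝓡∂ (n + 1)) (𝓡∂ (n + 1))
      ((fun x => S.θ (ℓ₂ - ℓ₁, x)) ∘ ((Subtype.val : ↥(S.f ⁻¹' Iic ℓ₁) → M) ∘
        (Subtype.val : S.flowCollar ℓ₁ ℓ₂ → ↥(S.f ⁻¹' Iic ℓ₁)))) y).toLinearMap ≠ 0 :=
    fun y => det_mfderiv_comp_ne_zero y (hθmd _) (hinner_md y) (S.det_mfderiv_flow_ne_zero _ _) (hinner_det y)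
  -- this composite is `val₂ ∘ Φ`
  have hfac : (fun x => S.θ (ℓ₂ - ℓ₁, x)) ∘ ((Subtype.val : ↥(S.f ⁻¹' Iic ℓ₁) → M) ∘
      (Subtype.val : S.flowCollar ℓ₁ ℓ₂ → ↥(S.f ⁻¹' Iic ℓ₁))) = (Subtype.val : ↥(S.f ⁻¹' Iic ℓ₂) → M) ∘ Φ := rfl
  rw [hfac] at hcomp hcomp_det
  have hΦmd : MDifferentiable (𝓡∂ (n + 1)) (𝓡∂ (n + 1)) Φ := (S.contMDiff_flowCollarMap hcs₁ hcs₂ h₁ h₂ hn).mdifferentiable hn'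
  -- the differential of `Φ` is invertible: `det val₂ · det Φ ≠ 0`
  have hΦdet : ∀ x, LinearMap.det (M := 𝔼 (n + 1)) (mfderiv (𝓡∂ (n + 1)) (𝓡∂ (n + 1)) Φ x).toLinearMap ≠ 0 := by
    intro x
    have h0 := hcomp_det x
    rw [mfderiv_comp x (hmd₂ _) (hΦmd x)] at h0
    have h1 := LinearMap.det_comp (M := 𝔼 (n + 1))
      (mfderiv (𝓡∂ (n + 1)) (𝓡∂ (n + 1)) (Subtype.val : ↥(S.f ⁻¹' Iic ℓ₂) → M) (Φ x)).toLinearMap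
      (mfderiv (𝓡∂ (n + 1)) (𝓡∂ (n + 1)) Φ x).toLinearMap
    have hprod := fun h => h0 (h1.trans h)
    exact (mul_ne_zero_iff.mp hprod).2
  exact ⟨IsOrientationPreserving.of_comp_left hcomp hval₂ hmd₂ hΦmd (S.det_mfderiv_val_ne_zero hcs₂ hn) hΦdet, hΦdet⟩

/-- **The flow map of the levels preserves the canonical level orientations.**
[cite: HirschDT1976, §4.4 p. 103] -/
theorem levelFlowDiffeomorph_isOrientationPreserving (oM : SmoothOrientation (𝓡∂ (n + 1)) M) (hn : 1 ≤ n) :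
    (S.levelFlowDiffeomorph hcs₁ hcs₂ h₁ h₂ hn).IsOrientationPreserving
      (S.levelOrientation hcs₁ oM hn) (S.levelOrientation hcs₂ oM hn) := by
  classical
  -- empty target: nothing to prove
  rcases isEmpty_or_nonempty ↥(S.f ⁻¹' Iic ℓ₂) with he | hne
  · intro z
    exact (he.false ((S.levelFlowDiffeomorph hcs₁ hcs₂ h₁ h₂ hn z) : ↥(S.f ⁻¹' Iic ℓ₂))).elim
  obtain ⟨hΦor, hΦdet⟩ := S.flowCollarMap_isOrientationPreserving hcs₁ hcs₂ h₁ h₂ oM hn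
  have hn' : (∞ : ℕ∞ω) ≠ 0 := by simp
  -- the global (junk-extended) map `W₁ → W₂`
  set Φ : ↥(S.f ⁻¹' Iic ℓ₁) → ↥(S.f ⁻¹' Iic ℓ₂) := fun x =>
    if h : S.lo < S.f x ∧ S.lo < S.f x + (ℓ₂ - ℓ₁) then S.flowCollarMap h₁ h₂ ⟨x, h⟩ else hne.some
    with hΦdef
  -- boundary points lie in the collar
  have hbd : ∀ z : S.Level ℓ₁, S.lo < S.f (S.levelIncl z) ∧ S.lo < S.f (S.levelIncl z) + (ℓ₂ - ℓ₁) := fun z => by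
    rw [S.apply_coe hcs₁ z]; exact ⟨h₁.1, by linarith [h₂.1]⟩
  have hΦU : Φ ∘ (Subtype.val : S.flowCollar ℓ₁ ℓ₂ → ↥(S.f ⁻¹' Iic ℓ₁)) = S.flowCollarMap h₁ h₂ := by
    funext x; exact dif_pos x.2
  have hΦz : ∀ z : S.Level ℓ₁, Φ z.1 = S.flowCollarMap h₁ h₂ ⟨z.1, hbd z⟩ := fun z => by
    exact dif_pos (hbd z)
  -- differentiability and the differential of `Φ` at boundary points
  have hΦat : ∀ z : S.Level ℓ₁, ContMDiffAt (𝓡∂ (n + 1)) (𝓡∂ (n + 1)) ∞ Φ z.1 := fun z => by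
    have := (S.contMDiff_flowCollarMap hcs₁ hcs₂ h₁ h₂ hn) ⟨z.1, hbd z⟩
    rw [← hΦU] at this
    exact (contMDiffAt_subtype_iff (U := S.flowCollar ℓ₁ ℓ₂) (x := ⟨z.1, hbd z⟩)).1 this
  have hmfd : ∀ z : S.Level ℓ₁, mfderiv (𝓡∂ (n + 1)) (𝓡∂ (n + 1)) Φ z.1 =
      mfderiv (𝓡∂ (n + 1)) (𝓡∂ (n + 1)) (S.flowCollarMap h₁ h₂) ⟨z.1, hbd z⟩ := fun z => by
    have hc : mfderiv (𝓡∂ (n + 1)) (𝓡∂ (n + 1)) (Φ ∘ (Subtype.val : S.flowCollar ℓ₁ ℓ₂ → ↥(S.f ⁻¹' Iic ℓ₁))) ⟨z.1, hbd z⟩ =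
        (mfderiv (𝓡∂ (n + 1)) (𝓡∂ (n + 1)) Φ z.1).comp
          (mfderiv (𝓡∂ (n + 1)) (𝓡∂ (n + 1)) (Subtype.val : S.flowCollar ℓ₁ ℓ₂ → ↥(S.f ⁻¹' Iic ℓ₁)) ⟨z.1, hbd z⟩) :=
      mfderiv_comp (⟨z.1, hbd z⟩ : S.flowCollar ℓ₁ ℓ₂) ((hΦat z).mdifferentiableAt hn') (mdifferentiableAt_subtype_val _)
    rw [mfderiv_subtype_val] at hc
    have e1 : mfderiv (𝓡∂ (n + 1)) (𝓡∂ (n + 1)) Φ z.1 =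
        (mfderiv (𝓡∂ (n + 1)) (𝓡∂ (n + 1)) Φ z.1).comp (ContinuousLinearMap.id ℝ (𝔼 (n + 1))) :=
      (ContinuousLinearMap.comp_id _).symm
    have e2 : mfderiv (𝓡∂ (n + 1)) (𝓡∂ (n + 1)) (Φ ∘ (Subtype.val : S.flowCollar ℓ₁ ℓ₂ → ↥(S.f ⁻¹' Iic ℓ₁)))
        (⟨z.1, hbd z⟩ : S.flowCollar ℓ₁ ℓ₂) =
        mfderiv (𝓡∂ (n + 1)) (𝓡∂ (n + 1)) (S.flowCollarMap h₁ h₂) (⟨z.1, hbd z⟩ : S.flowCollar ℓ₁ ℓ₂) := by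
      rw [hΦU]
    exact e1.trans (hc.symm.trans e2)
  refine isOrientationPreserving_boundaryMap_local (Φ := Φ) (fun z => ?_) (fun z => (hΦat z).mdifferentiableAt hn')
    (S.levelFlowDiffeomorph hcs₁ hcs₂ h₁ h₂ hn).continuous (fun z => by rw [hmfd z]; exact hΦdet _) fun z => ?_
  · -- `ρ` restricts `Φ`
    rw [hΦz z]; rfl
  · rw [hmfd z, hΦz z]
    have := hΦor ⟨z.1, hbd z⟩
    rwa [SmoothOrientation.restrict_apply] at this

end UnitSlab

end Literature.Topology.FourManifolds
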